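import Summits.BirchSwinnertonDyer.Rank1Residual.Supersingular.SignedRankZero
import Literature.NumberTheory.EllipticCurves.Kobayashi2003.SignedSelmer
import Literature.NumberTheory.EllipticCurves.IwasawaAlgebraMuVanishingProofs
import HarnessLib

/-!
# Route `ThetaPartnerAtTwo`, crux K2 `SignedMainConjectureCMTwo` (item stmt-BirchSwinnertonDyer-20307):
# a NUMERICAL BOUND for `μ⁺` at `2` from control alone — `μ⁺(E) ≤ ord₂ ∏c_ℓ(E) + ord₂ #Ш(E)`

HONEST FRAMING (cell `pub/bsd-wall`, W-ALL row 1, prover seat `bsd-wall-tp2-p2`): the crux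
`Summit.BirchSwinnertonDyer.BirchSwinnertonDyer.Theses.ThetaPartnerAtTwo.SignedMainConjectureCMTwo`
asks, for every CM `A/ℚ` good supersingular at `2` with `a₂ = 0`, that `X⁺(A/ℚ_∞)` be `Λ`-torsion
with `μ⁺ = 0` and that Kobayashi's `+` main conjecture hold at `2` (Pollack–Rubin Thm. 7.3 ported to
`p = 2`; NOT in print, NOT proved here). This route-independent file (no `Theses` import) bounds the
`μ⁺ = 0` conjunct by ARITHMETIC INVARIANTS OF `E` ALONE, for any `E/ℚ` (globally minimal) with
`L(E,1) ≠ 0`, granted Gross–Zagier–Kolyvagin (PUB, by name) and B. D. Kim's control term at `2`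
(research binder — verbatim the `p = 2` body used by the tree door
`bsdp_two_of_kobayashiMainConjecture_two_of_frobeniusTrace_eq_zero` and by crux K4c `SignedControlAtTwo`;
Kim 2013 Cor. 3.15 is printed for odd `p`):

* `mu_le_padicValNat_tamagawa_add_sha_two` — for every finitely generated `Λ`-torsion dual datum `D`
  of `Sel⁺(E/ℚ_∞)`: `μ⁺ = D.mu ≤ ord₂ ∏c_ℓ(E) + ord₂ #Ш(E)`. Proof: by the structure theory of
  `Λ`-modules PROVED in the tree (`exists_isPseudoIsomorphism_elementary_holds`,
  `charIdeal_eq_span_holds`, `muInvariant_eq_sum_holds`) `char X⁺ = (2^{μ}·∏ fⱼ^{nⱼ})`; Kim's term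
  with GZK (`#Sel_{2^∞}(E/ℚ) = #Ш[2^∞]`, `valuation_constantCoeff_xi`) gives
  `ord₂ (2^{μ}·∏ fⱼ^{nⱼ})(0) = ord₂ ∏c_ℓ + ord₂ #Ш`, and `(∏ fⱼ^{nⱼ})(0) ∈ ℤ₂`.
* `charIdeal_eq_top_and_mu_eq_zero_of_odd_tamagawa_of_odd_sha_two` — if `∏c_ℓ(E)` and `#Ш(E)` are
  ODD, then `char X⁺(E/ℚ_∞) = Λ` and `μ⁺ = 0` (the generator's constant term is a `2`-adic unit, so
  the generator is a unit of `ℤ₂⟦T⟧`; `μ = 0` by `muInvariant_eq_zero_iff_exists_isUnit_coeff_of_charIdeal_eq_span`).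
  No `L`-value, no BSD₂, no period enters — compare the sibling file
  `ThetaPartnerAtTwoSignedMainConjectureCMTwoUnitZone.lean`, which reaches the same conclusion from
  `ord₂ L(E,1)/Ω_E = 0` through BSD₂. For the route's `d = 3` CM anchor `27a1` (`∏c_ℓ = 3`,
  `#Ш_an = 1`) this reads: `μ⁺(27a1) = 0` and `char X⁺ = Λ` GRANTED Kobayashi Thm. 1.2 and Kim
  Cor. 3.15 at `2` for that curve.

References: [Kobayashi2003] Thm. 1.2 (the object); [BDKim2013] Cor. 3.15; [Washington1997] §13.2;
[GreenbergVatsal2000] p. 2 (μ = 0 ⟺ p ∤ characteristic power series); [PollackRubin2004] Thm. 7.3 (p > 2).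
-/

set_option autoImplicit false
-- the Theorems namespace of this sub repeats the summit name by design (D-0017 nested layout)
set_option linter.dupNamespace false

noncomputable section

open scoped Classical

open WeierstrassCurve Literature.NumberTheory.EllipticCurves
  Literature.NumberTheory.EllipticCurves.Rank1Residual Literature.NumberTheory.EllipticCurves.Rank1Residual.Typed
  Literature.NumberTheory.EllipticCurves.Kobayashi2003 ZpExtension
  Summit.BirchSwinnertonDyer.Rank1Residual Summit.BirchSwinnertonDyer.Rank1Residual.Supersingular

namespace Summit.BirchSwinnertonDyer.BirchSwinnertonDyer.Theorems

variable (A : WeierstrassCurve ℚ) [A.IsElliptic]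

/-- **`μ⁺ ≤ ord₂ ∏c_ℓ + ord₂ #Ш` from control at `2`.** Let `E = W` be globally minimal with
`L(E,1) ≠ 0`; grant GZK (`hGZK`, PUB: rank `0`, `Ш` finite) and Kim's control term at `2` (`hKim`:
for a generator `g` of `char X⁺(E/ℚ_∞)`, `g(0) ∼ 2^{ord₂ ∏c_ℓ}·#Sel_{2^∞}(E/ℚ)`; research binder).
Then every finitely generated `Λ`-torsion Pontryagin-dual datum `D` of Kobayashi's `Sel⁺(E/ℚ_∞)` at
`p = 2` has `D.mu ≤ ord₂ ∏c_ℓ(E) + ord₂ #Ш(E)`: with `char X⁺ = (2^{Σμᵢ}·∏ fⱼ^{nⱼ})` (structure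
theory, `charIdeal_eq_span_holds`, `μ = Σμᵢ` by `muInvariant_eq_sum_holds`), the constant term of
this generator is `2^{μ}·c` with `c ∈ ℤ₂ ∖ {0}`, and its `2`-adic valuation is `ord₂ ∏c_ℓ + ord₂ #Ш`
(`valuation_constantCoeff_xi`). Nothing asserted beyond the binders.
[cite: BDKim2013, Cor. 3.15 (p. 199; p odd in print)] [cite: Washington1997, §13.2] -/
theorem mu_le_padicValNat_tamagawa_add_sha_two
    (hGZK : rank_eq_analyticRank_of_analyticRank_le_one) (hL : A.entireLFunction 1 ≠ 0)
    (hKim : ∀ (κ : ZpExtension ℚ 2) (γ : Field.absoluteGaloisGroup ℚ),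
      κ.IsCyclotomic → κ.IsTopGenerator γ →
      ∀ (D : SignedSelmerDualData A κ γ 1) [Module.Finite (IwasawaAlgebra 2) D.X],
        Module.IsTorsion (IwasawaAlgebra 2) D.X →
      ∀ g : IwasawaAlgebra 2, D.charIdeal = Ideal.span {g} → Finite (A.selmerGroupPInfty 2) →
        ∃ u : ℤ_[2]ˣ, ((PowerSeries.constantCoeff g : ℤ_[2]) : ℚ_[2]) =
          ((u : ℤ_[2]) : ℚ_[2]) * ((2 : ℕ) : ℚ_[2]) ^ (padicValNat 2 A.tamagawaProduct) *
            (Nat.card (A.selmerGroupPInfty 2) : ℚ_[2]))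
    {κ : ZpExtension ℚ 2} {γ : Field.absoluteGaloisGroup ℚ} (hκ : κ.IsCyclotomic)
    (hγ : κ.IsTopGenerator γ) (D : SignedSelmerDualData A κ γ 1)
    [Module.Finite (IwasawaAlgebra 2) D.X] (hTors : Module.IsTorsion (IwasawaAlgebra 2) D.X) :
    D.mu ≤ padicValNat 2 A.tamagawaProduct + padicValNat 2 A.shaOrder := by
  obtain ⟨μs, fs, -, hfs, hψ⟩ := exists_isPseudoIsomorphism_elementary_holds 2 D.X hTors
  have hfs' : ∀ f ∈ fs, f.1.IsDistinguishedAt (IsLocalRing.maximalIdeal ℤ_[2]) :=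
    fun f hf => (hfs f hf).1
  have hchar : D.charIdeal = Ideal.span {charElement 2 μs fs} := charIdeal_eq_span_holds 2 D.X hfs' hψ
  have hμ : D.mu = μs.sum := muInvariant_eq_sum_holds 2 D.X hfs' hψ
  -- Kim + GZK on the datum `ξ := 2^{Σμ}·∏ fⱼ^{nⱼ}`
  have hK : (⟨charElement 2 μs fs, 0, 0⟩ : SignedDatum A 2).EulerCharacteristic := fun hfin ↦
    hKim κ γ hκ hγ D hTors _ hchar hfin
  obtain ⟨hne, hval⟩ := valuation_constantCoeff_xi A 2 hGZK hL ⟨charElement 2 μs fs, 0, 0⟩ hK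
  -- the constant term is `2^{Σμ} · c`, `c ∈ ℤ₂`
  set c : ℤ_[2] := PowerSeries.constantCoeff ((fs.map fun f => (f.1 : IwasawaAlgebra 2) ^ f.2).prod)
    with hc_def
  have h0 : ((PowerSeries.constantCoeff (charElement 2 μs fs) : ℤ_[2]) : ℚ_[2]) =
      ((2 ^ μs.sum : ℕ) : ℚ_[2]) * ((c : ℤ_[2]) : ℚ_[2]) := by
    rw [charElement, map_mul, PowerSeries.constantCoeff_C, hc_def, PadicInt.coe_mul, PadicInt.coe_pow,
      PadicInt.coe_natCast, Nat.cast_pow]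
  have h2 : ((2 ^ μs.sum : ℕ) : ℚ_[2]) ≠ 0 := by exact_mod_cast pow_ne_zero _ two_ne_zero
  change ((PowerSeries.constantCoeff (charElement 2 μs fs) : ℤ_[2]) : ℚ_[2]) ≠ 0 at hne
  change (((PowerSeries.constantCoeff (charElement 2 μs fs) : ℤ_[2]) : ℚ_[2])).valuation = _ at hval
  have hc0 : ((c : ℤ_[2]) : ℚ_[2]) ≠ 0 := fun h => hne (by rw [h0, h, mul_zero])
  rw [h0, Padic.valuation_mul h2 hc0, Padic.valuation_natCast, padicValNat.prime_pow] at hval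
  have hcnn := valuation_coe_padicInt_nonneg c hc0
  have hle : (μs.sum : ℤ) ≤ (padicValNat 2 A.tamagawaProduct : ℤ) + padicValNat 2 A.shaOrder := by
    linarith
  rw [hμ]
  exact_mod_cast hle

/-- **`∏c_ℓ` odd and `#Ш` odd ⇒ `char X⁺(E/ℚ_∞) = Λ` and `μ⁺ = 0` at `2`, from control alone.**
Same setting (`L(E,1) ≠ 0`, GZK, Kim's control term at `2`, `D` f.g. `Λ`-torsion): if
`2 ∤ ∏c_ℓ(E)` and `2 ∤ #Ш(E)`, the (principal: `charIdeal_isPrincipal_holds`) characteristic ideal of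
`X⁺` has a generator whose constant term is a `2`-adic unit (`valuation_constantCoeff_xi`), hence a
unit generator (`PowerSeries.isUnit_iff_constantCoeff`): `char X⁺ = Λ`, and `μ⁺ = 0`
(`muInvariant_eq_zero_iff_exists_isUnit_coeff_of_charIdeal_eq_span`). No `L`-value, period or BSD₂
enters. Nothing asserted beyond the binders. [cite: BDKim2013, Cor. 3.15 (p. 199; p odd in print)]
[cite: GreenbergVatsal2000, p. 2, (1)–(2)] [cite: Washington1997, §13.2] -/
theorem charIdeal_eq_top_and_mu_eq_zero_of_odd_tamagawa_of_odd_sha_two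
    (hGZK : rank_eq_analyticRank_of_analyticRank_le_one) (hL : A.entireLFunction 1 ≠ 0)
    (hKim : ∀ (κ : ZpExtension ℚ 2) (γ : Field.absoluteGaloisGroup ℚ),
      κ.IsCyclotomic → κ.IsTopGenerator γ →
      ∀ (D : SignedSelmerDualData A κ γ 1) [Module.Finite (IwasawaAlgebra 2) D.X],
        Module.IsTorsion (IwasawaAlgebra 2) D.X →
      ∀ g : IwasawaAlgebra 2, D.charIdeal = Ideal.span {g} → Finite (A.selmerGroupPInfty 2) →
        ∃ u : ℤ_[2]ˣ, ((PowerSeries.constantCoeff g : ℤ_[2]) : ℚ_[2]) =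
          ((u : ℤ_[2]) : ℚ_[2]) * ((2 : ℕ) : ℚ_[2]) ^ (padicValNat 2 A.tamagawaProduct) *
            (Nat.card (A.selmerGroupPInfty 2) : ℚ_[2]))
    (hTam : ¬ 2 ∣ A.tamagawaProduct) (hSha : ¬ 2 ∣ A.shaOrder)
    {κ : ZpExtension ℚ 2} {γ : Field.absoluteGaloisGroup ℚ} (hκ : κ.IsCyclotomic)
    (hγ : κ.IsTopGenerator γ) (D : SignedSelmerDualData A κ γ 1)
    [Module.Finite (IwasawaAlgebra 2) D.X] (hTors : Module.IsTorsion (IwasawaAlgebra 2) D.X) :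
    D.charIdeal = ⊤ ∧ D.mu = 0 := by
  obtain ⟨g, hg⟩ := (charIdeal_isPrincipal_holds 2 D.X).principal
  have hchar : D.charIdeal = Ideal.span {g} := hg
  have hK : (⟨g, 0, 0⟩ : SignedDatum A 2).EulerCharacteristic := fun hfin ↦
    hKim κ γ hκ hγ D hTors g hchar hfin
  obtain ⟨hne, hval⟩ := valuation_constantCoeff_xi A 2 hGZK hL ⟨g, 0, 0⟩ hK
  change ((PowerSeries.constantCoeff g : ℤ_[2]) : ℚ_[2]) ≠ 0 at hne
  change (((PowerSeries.constantCoeff g : ℤ_[2]) : ℚ_[2])).valuation = _ at hval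
  rw [padicValNat.eq_zero_of_not_dvd hTam, padicValNat.eq_zero_of_not_dvd hSha] at hval
  have hnorm : ‖(PowerSeries.constantCoeff g : ℤ_[2])‖ = 1 := by
    rw [PadicInt.norm_def, Padic.norm_eq_zpow_neg_valuation hne, hval]
    simp
  have hunit : IsUnit g :=
    PowerSeries.isUnit_iff_constantCoeff.mpr (PadicInt.isUnit_iff.mpr hnorm)
  refine ⟨?_, ?_⟩
  · rw [hchar, Ideal.span_singleton_eq_top]
    exact hunit
  · change muInvariant 2 D.X = 0
    rw [muInvariant_eq_zero_iff_exists_isUnit_coeff_of_charIdeal_eq_span D.X hTors hg]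
    exact ⟨0, by rw [PowerSeries.coeff_zero_eq_constantCoeff]; exact PadicInt.isUnit_iff.mpr hnorm⟩

end Summit.BirchSwinnertonDyer.BirchSwinnertonDyer.Theorems

end
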